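import Mathlib.RingTheory.Trace.Basic
import Mathlib.RingTheory.Discriminant
import Mathlib.RingTheory.Norm.Basic
import Mathlib.Algebra.Ring.Parity
import HarnessLib

/-!
# Ring 2 · Habitat (seat `habitat1`, gen 22) — LEMMA E: the Euler normalisation of the Weil discriminant at CM points

HONEST FRAMING (cell `pub-hodge-ring2`, verbatim): research route conditional on HC_CM; not a corollary;
Q11.4-sentence-2 already refuted in dim ≥ 3. `HC_CM` (`Theses.RankFourFaces.CMAbelianHodge`) does not occur in this
file; no case of the Hodge conjecture is claimed; no named fact, no `sorry`; axioms standard. Everything below is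
ELEMENTARY FIELD THEORY (trace forms of a finite separable extension with a power basis), kernel-checked because it is
the one structural lemma on which the habitat tables' CM-point columns rest (HOME `HABITATS.md` §A11.2 "LEMMA E",
flagged there as "NOT done (i): a Lean statement of Lemma E").

## What the habitat uses it for (NOT typed here — the carriers have no CM constructor)

The Weil-type components of the cell are indexed by `(K = ℚ(√-d), 2n, δ = det H ∈ ℚˣ/Nm Kˣ)`
(`Ring2.Hypotheses.WeilClassesComponent n d δ`, `VanGeemen1994.HasWeilDiscriminantNondeg`; van Geemen LNM 1594,
4.14 and Lemma 5.2). A CM point of the component is built in print from a totally real field `L⁺ = ℚ(θ) = ℚ[x]/(f)`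
of degree `m = 2n`, the CM field `L = K·L⁺`, a balanced CM type and a totally-positive-on-the-type element
`α ∈ L⁺`: the Riemann form is `E(x, y) = Tr_{L/ℚ}(√-d · α · x ȳ)` (Shimura, *Abelian varieties with complex
multiplication*, §6.2 Thm. 4) and the attached `K`-Hermitian form is `H(x, y) = Tr_{L/K}(α x ȳ)`, whose Gram matrix
in the `K`-basis `1, θ, …, θ^{m-1}` of `L = L⁺ ⊗_ℚ K` is the RATIONAL matrix `(Tr_{L⁺/ℚ}(α θ^{i+j}))_{i,j}` — the
twisted trace Gram matrix of this file with base field `ℚ` and extension `L⁺` in place of `K`, `L`. Hence (habitat reading, HABITATS §A11.1):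
`det H = N_{L⁺/ℚ}(α) · disc(1, θ, …, θ^{m-1})` (`det_traceGram`), and in the EULER NORMALISATION `α = β / f′(θ)`:
`det H = (-1)^{m(m-1)/2} · N(β) = (-1)ⁿ · N(β)` EXACTLY (`det_traceGram_euler`, `det_traceGram_euler_of_dim_eq_two_mul`)
— the field discriminant `disc f` (60–100 digits for the octic–duodecic witnesses of the tables, never factored)
DROPS OUT, and the δ-class of the CM point is read off the norm of the chosen `β`: `δ ≡ (-1)ⁿ N(β)`, i.e. the point
lies on the component `a ≡ N(β) mod Nm Kˣ` in the tables' convention `det H ≡ (-1)ⁿ a`. With `β = 1` the point lies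
on the SPLIT component for every `L⁺` (`det_traceGram_inv_derivAtGen_of_dim_eq_two_mul`). This is how Table T7-A
(HOME `code/habitat_A/occupancy/`, 600/600 rows, two implementations) places an explicit simple CM point on every
δ-component `(K, 2n, a)`, `2 ≤ n ≤ 6`, `d ≤ 23`.

## What is proved (kernel; `K` any field, `L/K` finite separable, `pb` a power basis with generator `θ`, `m = pb.dim`)

* the twisted trace Gram matrix `(Tr_{L/K}(α · θ^i · θ^j))_{i,j < m}` is written out as a `Matrix.of` (no new
  definitions in this helper file); `traceGram_one` : for `α = 1` it is Mathlib's `Algebra.traceMatrix K pb.basis`.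
* `traceGram_eq_traceMatrix_mul` : `(Tr(α θ^i θ^j)) = traceMatrix · [x ↦ α x]` (matrix of multiplication by `α`
  in the power basis), hence `det_traceGram` : `det (Tr(α θ^i θ^j)) = discr(pb) · N_{L/K}(α)`.
* LEMMA E (a) (Euler) `trace_pow_mul_inv_derivAtGen` : `Tr_{L/K}(θ^i / f′(θ)) = 0` for `i + 1 < m` and `= 1` for
  `i + 1 = m` — repackaged from Mathlib's dual-basis theorem `Module.Basis.traceDual_powerBasis_eq`
  (the dual basis of `1, θ, …, θ^{m-1}` under the trace form is `b_i / f′(θ)`, `f(x)/(x - θ) = Σ b_i x^i`).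
* LEMMA E (c) `det_traceGram_euler` : `det (Tr(β θ^{i+j} / f′(θ))) = (-1)^{m(m-1)/2} · N_{L/K}(β)`;
  LEMMA E (b) `det_traceGram_inv_derivAtGen` : the case `β = 1`;
  `det_traceGram_euler_of_dim_eq_two_mul` / `det_traceGram_inv_derivAtGen_of_dim_eq_two_mul` : for `m = 2n` the sign
  is `(-1)ⁿ` (`neg_one_pow_two_mul_mul_sub_one_div_two`).
* `traceGram_inv_derivAtGen_apply_of_le` / `traceGram_inv_derivAtGen_apply_eq_zero_of_dim_eq_two_mul` : the
  Euler-normalised Gram matrix is anti-triangular with `1`s on the anti-diagonal; for `m = 2n` the span of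
  `1, θ, …, θ^{n-1}` is a rank-`n` totally isotropic subspace (the form is metabolic; for `β = 1` the habitat's
  `K`-Hermitian form is hyperbolic — the split class — not merely of split determinant).

PRINT STATUS. (a) is Euler's lemma (e.g. A. Baker, *A comprehensive course in number theory* (2012) p. 157;
J.-P. Serre, *Local Fields* III §6; Fröhlich–Taylor (1.4)–(1.5) for `N(f′(θ)) = (-1)^{m(m-1)/2} disc f`) and is in
Mathlib; `det_traceGram` is the discriminant of the SCALED TRACE FORM `Tr_{L/K}(⟨α⟩)` (standard; e.g. the
`𝔸¹`-enumerative literature, Brazelton–McKean–Pauli arXiv:2103.16614 Remark 8.1, where `Tr(x y / f′(θ))` is the global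
Scheja–Storch = Bézoutian form of `f`); (b)–(c) are the habitat seat's normalisation (HABITATS §A11.2, "A-DERIVED"), an
exercise, recorded here so that the CM-point columns of the habitat tables rest on a kernel identity rather than on
prose. FRESHNESS `## habitat1 (gen 22)` lists the searches run; nothing is claimed as new mathematics.

## References

* [vanGeemen1994HodgeAV] B. van Geemen, LNM 1594 (1994): 4.14, Lemma 5.2 (2)–(4).
* G. Shimura, Abelian varieties with complex multiplication and modular functions (1998), §6.2 Thm. 4.
* A. Baker, A comprehensive course in number theory (2012), p. 157 (Euler's lemma / dual basis of a power basis).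
* A. Fröhlich, M. J. Taylor, Algebraic number theory (1991), (1.4)–(1.5).
* T. Brazelton, S. McKean, S. Pauli, Bézoutians and the 𝔸¹-degree, arXiv:2103.16614, §4, Remark 8.1.
-/

set_option linter.dupNamespace false

noncomputable section

open Polynomial Module Matrix

namespace Summit.HodgeConjecture.HodgeConjecture.Ring2.Habitat

variable {K L : Type*} [Field K] [Field L] [Algebra K L]

/-! ### §1 The twisted trace Gram matrix of a power basis

Throughout, the TWISTED TRACE GRAM MATRIX of the power basis `pb` (generator `θ = pb.gen`, `m = pb.dim`) by `α : L` is
written out as `Matrix.of fun i j : Fin pb.dim => Algebra.trace K L (α * (pb.gen ^ i * pb.gen ^ j))`, i.e.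
`(Tr_{L/K}(α θ^i θ^j))_{i,j<m}` (no new definitions are introduced in this helper file). Habitat reading (module
docstring): with `K₀ = ℚ`, `L⁺ = ℚ(θ)` totally real of degree `2n` and `α` the polarisation parameter of a CM point of
Weil type, it is the Gram matrix of the `K`-Hermitian form `H` in the basis `θ^i ⊗ 1` of `L⁺ ⊗ K`. -/

/-- For `α = 1` the twisted trace Gram matrix is Mathlib's trace matrix of the power basis. -/
theorem traceGram_one (pb : PowerBasis K L) :
    (Matrix.of fun i j : Fin pb.dim => Algebra.trace K L (pb.gen ^ (i : ℕ) * pb.gen ^ (j : ℕ))) =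
      Algebra.traceMatrix K pb.basis := by
  ext i j
  simp [Algebra.traceMatrix_apply, Algebra.traceForm_apply, PowerBasis.coe_basis]

/-- **Factorisation.** `(Tr(α θ^i θ^j)) = traceMatrix(pb) · M_α`, `M_α` the matrix of `x ↦ α · x` in the power basis:
`Tr(α θ^i θ^j) = Σ_k Tr(θ^i θ^k) · (M_α)_{k j}` because `α θ^j = Σ_k (M_α)_{k j} θ^k`. -/
theorem traceGram_eq_traceMatrix_mul (pb : PowerBasis K L) (α : L) :
    (Matrix.of fun i j : Fin pb.dim => Algebra.trace K L (α * (pb.gen ^ (i : ℕ) * pb.gen ^ (j : ℕ)))) =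
      Algebra.traceMatrix K pb.basis * LinearMap.toMatrix pb.basis pb.basis (Algebra.lmul K L α) := by
  ext i j
  rw [Matrix.mul_apply, Matrix.of_apply]
  have hsum : α * pb.gen ^ (j : ℕ) =
      ∑ k : Fin pb.dim, pb.basis.repr (α * pb.gen ^ (j : ℕ)) k • pb.gen ^ (k : ℕ) := by
    conv_lhs => rw [← pb.basis.sum_repr (α * pb.gen ^ (j : ℕ))]
    simp [PowerBasis.coe_basis]
  have hrw : α * (pb.gen ^ (i : ℕ) * pb.gen ^ (j : ℕ)) = pb.gen ^ (i : ℕ) * (α * pb.gen ^ (j : ℕ)) := by ring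
  rw [hrw, hsum, Finset.mul_sum, map_sum]
  refine Finset.sum_congr rfl fun k _ => ?_
  rw [Algebra.traceMatrix_apply, Algebra.traceForm_apply, LinearMap.toMatrix_apply, PowerBasis.coe_basis]
  simp only [Algebra.coe_lmul_eq_mul, LinearMap.mul_apply']
  rw [mul_smul_comm, LinearMap.map_smul, smul_eq_mul, mul_comm]

/-- **`det (Tr(α θ^i θ^j)) = disc(pb) · N_{L/K}(α)`** — the discriminant of the scaled trace form `Tr_{L/K}(⟨α⟩)`;
the α-normalisation of the habitat tables (`det H = N(α) · disc(1, θ, …, θ^{m-1})`, HABITATS §A11.1). -/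
theorem det_traceGram (pb : PowerBasis K L) (α : L) :
    (Matrix.of fun i j : Fin pb.dim => Algebra.trace K L (α * (pb.gen ^ (i : ℕ) * pb.gen ^ (j : ℕ)))).det =
      Algebra.discr K pb.basis * Algebra.norm K α := by
  rw [traceGram_eq_traceMatrix_mul, Matrix.det_mul, Algebra.discr_def, LinearMap.det_toMatrix,
    Algebra.norm_apply]

/-! ### §2 The Euler normalisation (finite separable `L/K`)

`f′(θ)` is written out as `aeval pb.gen (derivative (minpoly K pb.gen))`. -/

/-- The top coefficient of `f(x)/(x - θ)` is `1` (`f = minpoly K θ`, monic of degree `m`). -/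
theorem coeff_minpolyDiv_dim_sub_one (pb : PowerBasis K L) :
    (minpolyDiv K pb.gen).coeff (pb.dim - 1) = 1 := by
  have hdeg : (minpolyDiv K pb.gen).natDegree = pb.dim - 1 := by
    rw [natDegree_minpolyDiv, pb.natDegree_minpoly]
  rw [← hdeg]
  exact (minpolyDiv_monic pb.isIntegral_gen).coeff_natDegree

/-- `f′(θ) ≠ 0` (separability). -/
theorem derivAtGen_ne_zero [Algebra.IsSeparable K L] (pb : PowerBasis K L) :
    aeval pb.gen (derivative (minpoly K pb.gen)) ≠ 0 :=
  (Algebra.IsSeparable.isSeparable K pb.gen).aeval_derivative_ne_zero (minpoly.aeval K pb.gen)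

/-- `N_{L/K}(1/f′(θ)) = 1 / N_{L/K}(f′(θ))`. -/
theorem norm_inv_derivAtGen [Algebra.IsSeparable K L] (pb : PowerBasis K L) :
    Algebra.norm K (aeval pb.gen (derivative (minpoly K pb.gen)))⁻¹ =
      (Algebra.norm K (aeval pb.gen (derivative (minpoly K pb.gen))))⁻¹ := by
  refine eq_inv_of_mul_eq_one_left ?_
  rw [← map_mul, inv_mul_cancel₀ (derivAtGen_ne_zero pb), map_one]

section Separable

variable [FiniteDimensional K L] [Algebra.IsSeparable K L]

/-- `N_{L/K}(f′(θ)) ≠ 0`. -/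
theorem norm_derivAtGen_ne_zero (pb : PowerBasis K L) :
    Algebra.norm K (aeval pb.gen (derivative (minpoly K pb.gen))) ≠ 0 :=
  Algebra.norm_ne_zero_iff.mpr (derivAtGen_ne_zero pb)

/-- `disc(pb) = (-1)^{m(m-1)/2} · N_{L/K}(f′(θ))` (Mathlib's `Algebra.discr_powerBasis_eq_norm`, with
`finrank K L = pb.dim`; Fröhlich–Taylor (1.4)–(1.5)). -/
theorem discr_eq_neg_one_pow_mul_norm_derivAtGen (pb : PowerBasis K L) :
    Algebra.discr K pb.basis =
      (-1) ^ (pb.dim * (pb.dim - 1) / 2) * Algebra.norm K (aeval pb.gen (derivative (minpoly K pb.gen))) := by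
  rw [Algebra.discr_powerBasis_eq_norm, PowerBasis.finrank]

/-- **LEMMA E (c).** In the Euler normalisation `α = β / f′(θ)`:
`det (Tr_{L/K}(β · θ^i θ^j / f′(θ)))_{i,j<m} = (-1)^{m(m-1)/2} · N_{L/K}(β)` — the discriminant drops out.
Habitat reading: the CM point with polarisation parameter `β/f′(θ)` lies on the δ-component `(-1)ⁿ · det H ≡ N(β)`
(`m = 2n`; `det_traceGram_euler_of_dim_eq_two_mul`). -/
theorem det_traceGram_euler (pb : PowerBasis K L) (β : L) :
    (Matrix.of fun i j : Fin pb.dim => Algebra.trace K L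
        (β * (aeval pb.gen (derivative (minpoly K pb.gen)))⁻¹ * (pb.gen ^ (i : ℕ) * pb.gen ^ (j : ℕ)))).det =
      (-1) ^ (pb.dim * (pb.dim - 1) / 2) * Algebra.norm K β := by
  rw [det_traceGram, discr_eq_neg_one_pow_mul_norm_derivAtGen, map_mul, norm_inv_derivAtGen]
  have h := norm_derivAtGen_ne_zero pb
  set N := Algebra.norm K (aeval pb.gen (derivative (minpoly K pb.gen))) with hN
  calc (-1 : K) ^ (pb.dim * (pb.dim - 1) / 2) * N * (Algebra.norm K β * N⁻¹)
      = (-1) ^ (pb.dim * (pb.dim - 1) / 2) * Algebra.norm K β * (N * N⁻¹) := by ring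
    _ = (-1) ^ (pb.dim * (pb.dim - 1) / 2) * Algebra.norm K β := by rw [mul_inv_cancel₀ h, mul_one]

/-- **LEMMA E (b).** `det (Tr_{L/K}(θ^i θ^j / f′(θ)))_{i,j<m} = (-1)^{m(m-1)/2}` (the Gram matrix is anti-triangular
with `1`s on the anti-diagonal, by (a)). Habitat reading: `β = 1` puts the CM point on the SPLIT component. -/
theorem det_traceGram_inv_derivAtGen (pb : PowerBasis K L) :
    (Matrix.of fun i j : Fin pb.dim => Algebra.trace K L
        ((aeval pb.gen (derivative (minpoly K pb.gen)))⁻¹ * (pb.gen ^ (i : ℕ) * pb.gen ^ (j : ℕ)))).det =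
      (-1) ^ (pb.dim * (pb.dim - 1) / 2) := by
  have h := det_traceGram_euler pb 1
  rwa [one_mul, map_one, mul_one] at h

/-- The LAST vector of the trace-dual basis of the power basis is `1 / f′(θ)`
(Mathlib `Module.Basis.traceDual_powerBasis_eq` + `coeff_minpolyDiv_dim_sub_one`). -/
theorem traceDual_eq_inv_derivAtGen (pb : PowerBasis K L) (j : Fin pb.dim) (hj : (j : ℕ) + 1 = pb.dim) :
    pb.basis.traceDual j = (aeval pb.gen (derivative (minpoly K pb.gen)))⁻¹ := by
  have hj' : (j : ℕ) = pb.dim - 1 := by omega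
  rw [Module.Basis.traceDual_powerBasis_eq, hj', coeff_minpolyDiv_dim_sub_one, one_div]

/-- **LEMMA E (a) — Euler's lemma.** `Tr_{L/K}(θ^i / f′(θ)) = 0` for `i + 1 < m` and `= 1` for `i + 1 = m`
(`0 ≤ i < m`): the last dual-basis vector of `1, θ, …, θ^{m-1}` under the trace form is `1/f′(θ)`
(Mathlib `Module.Basis.traceDual_powerBasis_eq`, after Euler: partial fractions of `1/f`). -/
theorem trace_pow_mul_inv_derivAtGen (pb : PowerBasis K L) (i : Fin pb.dim) :
    Algebra.trace K L (pb.gen ^ (i : ℕ) * (aeval pb.gen (derivative (minpoly K pb.gen)))⁻¹) =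
      if (i : ℕ) + 1 = pb.dim then 1 else 0 := by
  set jl : Fin pb.dim := ⟨pb.dim - 1, Nat.sub_lt pb.dim_pos Nat.one_pos⟩ with hjl
  have hjv : (jl : ℕ) + 1 = pb.dim := by
    have := pb.dim_pos
    simp only [hjl]
    omega
  have h := Module.Basis.trace_mul_traceDual pb.basis i jl
  rw [traceDual_eq_inv_derivAtGen pb jl hjv, PowerBasis.coe_basis] at h
  simp only at h
  rw [h]
  by_cases hlast : (i : ℕ) + 1 = pb.dim
  · have heq : i = jl := Fin.ext (by simp only [hjl]; omega)
    rw [if_pos heq, if_pos hlast]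
  · have hne : i ≠ jl := fun heq => hlast (by rw [heq]; exact hjv)
    rw [if_neg hne, if_neg hlast]

/-- The entries of the Euler-normalised Gram matrix ON AND ABOVE the anti-diagonal: `Tr(θ^i θ^j / f′(θ)) = 0` if
`i + j + 1 < m`, `= 1` if `i + j + 1 = m` (anti-triangular shape; the entries below the anti-diagonal are not needed). -/
theorem traceGram_inv_derivAtGen_apply_of_le (pb : PowerBasis K L) (i j : Fin pb.dim)
    (hij : (i : ℕ) + j + 1 ≤ pb.dim) :
    (Matrix.of fun i j : Fin pb.dim => Algebra.trace K L
        ((aeval pb.gen (derivative (minpoly K pb.gen)))⁻¹ * (pb.gen ^ (i : ℕ) * pb.gen ^ (j : ℕ)))) i j =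
      if (i : ℕ) + j + 1 = pb.dim then 1 else 0 := by
  have hk : (i : ℕ) + j < pb.dim := by omega
  have h := trace_pow_mul_inv_derivAtGen pb ⟨(i : ℕ) + j, hk⟩
  simp only at h
  rw [Matrix.of_apply, ← pow_add, mul_comm, h]

/-- **Lagrangian half.** For `m = 2n` the span of `1, θ, …, θ^{n-1}` is TOTALLY ISOTROPIC for the Euler-normalised
trace form: `Tr_{L/K}(θ^i θ^j / f′(θ)) = 0` for `i, j < n` (`i + j + 1 ≤ 2n - 1 < m`). So the form is metabolic of rank
`2n` with a rank-`n` Lagrangian, in accordance with `det = (-1)ⁿ` (`det_traceGram_inv_derivAtGen_of_dim_eq_two_mul`);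
habitat reading: for `β = 1` the `K`-Hermitian form `H(x, y) = Tr_{L/K}(x ȳ / f′(θ))` on `L⁺ ⊗ K` has the totally
isotropic `K`-subspace `⊕_{i<n} K θ^i`, i.e. it is the hyperbolic Hermitian form of rank `2n` — the SPLIT δ-class.
(The Euler-normalised form `Tr_{L/K}(x y / f′(θ))` on `L = K[x]/(f)` is the global Scheja–Storch = Bézoutian form of
`f`, cf. Brazelton–McKean–Pauli, arXiv:2103.16614, §4 and Remark 8.1 ("scaled trace form"); nothing here is new.) -/
theorem traceGram_inv_derivAtGen_apply_eq_zero_of_dim_eq_two_mul (pb : PowerBasis K L) {n : ℕ}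
    (hn : pb.dim = 2 * n) (i j : Fin pb.dim) (hi : (i : ℕ) < n) (hj : (j : ℕ) < n) :
    (Matrix.of fun i j : Fin pb.dim => Algebra.trace K L
        ((aeval pb.gen (derivative (minpoly K pb.gen)))⁻¹ * (pb.gen ^ (i : ℕ) * pb.gen ^ (j : ℕ)))) i j = 0 := by
  rw [traceGram_inv_derivAtGen_apply_of_le pb i j (by omega), if_neg (by omega)]

end Separable

/-! ### §3 The sign for `m = 2n`: `(-1)^{m(m-1)/2} = (-1)ⁿ` -/

/-- `(2n)(2n-1)/2 = n(2n-1)` in `ℕ`. -/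
theorem two_mul_mul_sub_one_div_two (n : ℕ) : 2 * n * (2 * n - 1) / 2 = n * (2 * n - 1) := by
  rw [Nat.mul_assoc, Nat.mul_div_cancel_left _ Nat.two_pos]

/-- `(-1)^{(2n)(2n-1)/2} = (-1)ⁿ` in any ring. -/
theorem neg_one_pow_two_mul_mul_sub_one_div_two {R : Type*} [Ring R] (n : ℕ) :
    (-1 : R) ^ (2 * n * (2 * n - 1) / 2) = (-1) ^ n := by
  rw [two_mul_mul_sub_one_div_two]
  rcases Nat.even_or_odd n with hn | hn
  · rw [hn.neg_one_pow, (hn.mul_right _).neg_one_pow]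
  · have hodd : Odd (n * (2 * n - 1)) := by
      refine hn.mul ?_
      obtain ⟨k, rfl⟩ := hn
      exact ⟨2 * k, by omega⟩
    rw [hn.neg_one_pow, hodd.neg_one_pow]

section Separable

variable [FiniteDimensional K L] [Algebra.IsSeparable K L]

/-- **LEMMA E (c), habitat form.** For a power basis of EVEN dimension `m = 2n`:
`det (Tr(β θ^i θ^j / f′(θ))) = (-1)ⁿ · N(β)` — so in the tables' convention `det H ≡ (-1)ⁿ a` the CM point with
parameter `β / f′(θ)` lies on the component `a ≡ N(β) mod Nm Kˣ`. -/
theorem det_traceGram_euler_of_dim_eq_two_mul (pb : PowerBasis K L) {n : ℕ} (hn : pb.dim = 2 * n) (β : L) :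
    (Matrix.of fun i j : Fin pb.dim => Algebra.trace K L
        (β * (aeval pb.gen (derivative (minpoly K pb.gen)))⁻¹ * (pb.gen ^ (i : ℕ) * pb.gen ^ (j : ℕ)))).det =
      (-1) ^ n * Algebra.norm K β := by
  rw [det_traceGram_euler, hn, neg_one_pow_two_mul_mul_sub_one_div_two]

/-- **The split component.** For `m = 2n` and `β = 1`: `det (Tr(θ^i θ^j / f′(θ))) = (-1)ⁿ`, the trivial class —
the CM point `A_{1/f′(θ)}` lies on the SPLIT component `a = 1` of `(K, 2n)` for EVERY totally real `L⁺` of degree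
`2n` (HABITATS §A11.2 (e): a search-free occupancy proof for the 80 split rows of Table H). -/
theorem det_traceGram_inv_derivAtGen_of_dim_eq_two_mul (pb : PowerBasis K L) {n : ℕ} (hn : pb.dim = 2 * n) :
    (Matrix.of fun i j : Fin pb.dim => Algebra.trace K L
        ((aeval pb.gen (derivative (minpoly K pb.gen)))⁻¹ * (pb.gen ^ (i : ℕ) * pb.gen ^ (j : ℕ)))).det =
      (-1) ^ n := by
  rw [det_traceGram_inv_derivAtGen, hn, neg_one_pow_two_mul_mul_sub_one_div_two]

end Separable

end Summit.HodgeConjecture.HodgeConjecture.Ring2.Habitat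

end
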